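import Summits.HodgeConjecture.HodgeConjecture.Theorems.Ring2AbelianAllLefschetzPencilsOnPath
import Summits.HodgeConjecture.HodgeConjecture.Theorems.Ring2AbelianAllStandardAPencilsTransport
import Literature.AlgebraicGeometry.HodgeTheory.LefschetzOneOneHolds
import Literature.AlgebraicGeometry.HodgeTheory.AlgebraicClassesCupSubmaximalDegree
import Literature.AlgebraicGeometry.HodgeTheory.AbelianLowDimensionHodgeConjecture
import HarnessLib

/-!
# Ring 2 — hypotheses layer, descent axis: binder row b05 `MotivatedImpliesAlgebraicAV` — the bridges from
# the typed node `X = B(compact abelian pencils)` with André's span fact DISCHARGED, and the binder-free RUNGS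

HONEST FRAMING (page 1, verbatim the cell's standing line): **research route conditional on HC_CM; not a
corollary; Q11.4-sentence-2 already refuted in dim ≥ 3.** Nothing in this file proves a case of the Hodge
conjecture beyond the classical Lefschetz range, and nothing asserts `HC_CM`
(= `Theses.RankFourFaces.CMAbelianHodge`, a BINDER of the cell, referred to by name only, never restated),
`HC_AV` (= `Theses.PadicSemiregularLift.HodgeAbelianVarieties`) or `HodgeConjecture`.

Hodge ladder STAGE 3, `BINDER-OWNERS.md` row **b05** (binder
`Ring2.Hypotheses.MotivatedImpliesAlgebraicAV`, `Ring2HypothesesDescent.lean` l.177; parent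
`MotivatedImpliesAlgebraic`, l.167): "published modulo `X`", `X` := Grothendieck's standard conjecture `B`
for the total spaces of compact pencils of abelian varieties (André 1996, §6.3 Remarque 2, p. 33: "Ce
théorème ramène en particulier la conjecture de Hodge pour les variétés abéliennes à la question de savoir
si l'involution de Lefschetz (ou de Hodge) sur les pinceaux compacts de variétés abéliennes est donnée par
une correspondance algébrique"). `X` is TYPED in the tree, three times, BY NAME — `⋆_L`-form
`Ring2.AbelianAll.CompactAbelianPencilLefschetz` (`Ring2AbelianAllLefschetzPencils`, seat ab-andre-1) ≡
`Ring2.AbelianAll.LefschetzBCompactPencils` (`Ring2AbelianAllAndreLefschetz`, seat ab-andre-2; `Iff.rfl`,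
`Ring2AbelianAllAndreJunction`), and print's own letter `A`, `Ring2.AbelianAll.CompactAbelianPencilStandardA`
(`Ring2AbelianAllStandardAPencils`) — and the bridge `X ⟹ b05` is LANDED
(`Ring2.AbelianAll.motivatedImpliesAlgebraicAV_of_abdulali_of_andre1996_of_compactAbelianPencilLefschetz`)
modulo four named facts `h₈ h₂₁ h₂₂ hMH`. This file re-types nothing; it adds (append-only, new module):

* §1 THE REMAINING BRIDGES WITH ONE BINDER FEWER. André's span fact `hMH` (§2.5 c): motivated classes lie in
  the `ℂ`-span of the Hodge classes) is a tree THEOREM (`Andre1996_motivatedClasses_le_span_hodgeClasses_holds`), and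
  the `hMH`-free bridge `X ⟹ b05` is ALREADY LANDED (ab-andre-1 part VI,
  `Ring2.AbelianAll.motivatedImpliesAlgebraicAV_of_abdulali_of_andre1996_of_compactAbelianPencilLefschetz_holds`,
  `Ring2AbelianAllLefschetzPencilsOnPath`; modulo `h₈` = Abdulali 1994 p. 1122 typed with hypothesis `B(𝒳)`,
  `h₂₁` = André Lemme 6.3.1, `h₂₂` = Lemmes 6.3.2–6.3.3) — it is IMPORTED here, not re-proved (count once; the
  ab-andre-2 spelling `LefschetzBCompactPencils` is the same statement by `Iff.rfl`). NEW here: `X_A ⟹ b05`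
  modulo `h₈A` (Abdulali p. 1122 with the Lefschetz hypothesis AS PRINTED, `A(𝒳, η)`), `h₂₁`, `h₂₂`; and the
  variational rows `CompactAbelianPencilVHC ⟹ b05`, `AbelianSchemeVHC ⟹ b05` (row b02 ⟹ row b05) modulo
  `h₂₁ h₂₂` only. Every bridge passes through `HC_AV` (KIND 1: on this axis `HC_CM` is idle in print and in
  the kernel).
* §2 THE RUNGS, BINDER-FREE (no named fact, no `HC_CM`): `A_motᵖ(X)_ℂ ⊆ Nᵖ H²ᵖ(X(ℂ); ℂ)` for every smooth
  projective complex `n`-fold in the Lefschetz range `p ≤ 1 ∨ n ≤ p + 1` and for every `n ≤ 3` — from the two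
  tree theorems `Andre1996_motivatedClasses_le_span_hodgeClasses_holds` (motivated ⟹ span of Hodge) and
  `mem_algebraicClasses_of_lefschetzRange_holds` / `hodgeClasses_algebraic_of_dim_le_three_holds` (Hodge ⟹
  algebraic there: Lefschetz `(1,1)` and hard Lefschetz, Voisin I Thm. 6.25 / 11.30, Voisin II proof of
  Prop. 10.26). Specialised to abelian varieties these are typer2's sub-item (m2):
  `MotivatedImpliesAlgebraicAV` for `dim A ≤ 3`, and for every `A` in codimensions `p ≤ 1`, `p ≥ dim A − 1`.
* §3 THE RESIDUE, as kernel `Iff`s: `MotivatedImpliesAlgebraic[AV]` is EQUIVALENT to its restriction to the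
  middle codimensions `2 ≤ p ≤ n − 2` (so `n ≥ 4`) — the exact range in which row b05 has content; and the
  `dim ≤ 5` rung modulo the one print claim `Markman2025_hodgeClasses_algebraic_abelian_dim_le_five`
  (arXiv:2509.23403 Cor. 1.3, UNREFEREED, displayed as a hypothesis, never asserted).
* §4 one ledger conjunction a referee can quote.

Discharge status of row b05 after this file: UNCHANGED (OPEN; `≡ HC_AV` modulo André Thm. 0.6.2, part XXV
`hc_av_iff_motivatedImpliesAlgebraicAV_holds`). What is binder-free is exactly the Lefschetz range and
`dim ≤ 3`; the numbers of `BINDER-OWNERS.md` («10 · 0») do not move.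

References (bib keys): Andre1996Motifs (Thm. 0.6.2 p. 9; §2.1 Déf. 1 and remark p. 14; §2.5 c) p. 18; §6.3
Lemmes 6.3.1–6.3.3 and Remarque 2, pp. 31–33), Abdulali1994FamiliesAV (pp. 1122–1123, Lemma 6.2 and Thm. 6.1
p. 1131), Milne2020HodgeClassesAV (Prop. 1, Thm. 4, Rem. 3), VoisinHodgeI2002 (Thm. 6.25, Rem. 6.27, §7.1.2,
Thm. 11.30), VoisinHodgeII2003 (§10.2.3 proof of Prop. 10.26), KerrPearlstein2011 (§3.1), Murre1977 (Remark 1),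
Markman2025SurveySecant (arXiv:2509.23403 Cor. 1.3, claim).
-/

set_option linter.dupNamespace false

noncomputable section

open CategoryTheory
open Literature.AlgebraicGeometry Literature.AlgebraicGeometry.Motives
open Literature.AlgebraicGeometry.HodgeTheory
open Literature.AlgebraicGeometry.Abdulali1994 (Abdulali1994_invariantCycles_of_lefschetzStandard
  Abdulali1994_invariantCycles_of_lefschetzStandardA)
open Literature.AlgebraicGeometry.Andre1996 (andre1996_cmAnchoredPencil
  andre1996_cmHodgeClasses_algebraicallyAnchoredPencils)
open Summit.HodgeConjecture.HodgeConjecture.Ring2.AbelianAll (CompactAbelianPencilLefschetz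
  CompactAbelianPencilStandardA HC_AV_and_HC_CM_of_abdulaliA_of_andre1996_of_compactAbelianPencilStandardA)
open Summit.HodgeConjecture.HodgeConjecture.Ring2.Deform (CompactAbelianPencilVHC
  HC_AV_of_andre1996_of_compactAbelianPencilVHC HC_AV_of_andre1996_of_abelianSchemeVHC)

namespace Summit.HodgeConjecture.HodgeConjecture.Ring2.Hypotheses

/-! ## §1 The bridges into row b05 with André's span fact discharged -/

/-- **`X_A ⟹ b05` — print's own letter**: Grothendieck's `A(𝒳, η)` for every polarisation class of the total space
of every compact abelian pencil (`Ring2.AbelianAll.CompactAbelianPencilStandardA`) gives `MotivatedImpliesAlgebraicAV`,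
granted Abdulali p. 1122 with the Lefschetz hypothesis AS PRINTED (`h₈A`), Lemme 6.3.1 (`h₂₁`) and Lemmes
6.3.2–6.3.3 (`h₂₂`); André's span fact is theorem-fed. Through the landed
`Ring2.AbelianAll.HC_AV_and_HC_CM_of_abdulaliA_of_andre1996_of_compactAbelianPencilStandardA`.
[cite: Abdulali1994FamiliesAV, p. 1122 and Thm. 6.1 (p. 1131)] [cite: Milne2020HodgeClassesAV, Prop. 1 (p. 7) and Thm. 4]
[cite: Andre1996Motifs, §6.3 Remarque 2 (p. 33)] -/
theorem motivatedImpliesAlgebraicAV_of_abdulaliA_of_andre1996_of_compactAbelianPencilStandardA_holds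
    (h₈A : Abdulali1994_invariantCycles_of_lefschetzStandardA) (h₂₁ : andre1996_cmAnchoredPencil)
    (h₂₂ : andre1996_cmHodgeClasses_algebraicallyAnchoredPencils) (hA : CompactAbelianPencilStandardA) :
    MotivatedImpliesAlgebraicAV :=
  motivatedImpliesAlgebraicAV_of_hc_av_holds
    (HC_AV_and_HC_CM_of_abdulaliA_of_andre1996_of_compactAbelianPencilStandardA h₈A h₂₁ h₂₂ hA).1

/-- **The variational row: `CompactAbelianPencilVHC ⟹ b05`** granted Lemmes 6.3.1–6.3.3 only (`h₂₁`, `h₂₂`) —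
deform IV (M′) `Ring2.Deform.HC_AV_of_andre1996_of_compactAbelianPencilVHC` followed by part XXV; no Abdulali fact,
no span fact, no `HC_CM`. [cite: Andre1996Motifs, §6.3 (pp. 31–33) and Thm. 0.5 (p. 8)] -/
theorem motivatedImpliesAlgebraicAV_of_andre1996_of_compactAbelianPencilVHC_holds
    (h₂₁ : andre1996_cmAnchoredPencil) (h₂₂ : andre1996_cmHodgeClasses_algebraicallyAnchoredPencils)
    (hV : CompactAbelianPencilVHC) : MotivatedImpliesAlgebraicAV :=
  motivatedImpliesAlgebraicAV_of_hc_av_holds (HC_AV_of_andre1996_of_compactAbelianPencilVHC h₂₁ h₂₂ hV)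

/-- **Row b02 ⟹ row b05: `AbelianSchemeVHC ⟹ MotivatedImpliesAlgebraicAV`** granted Lemmes 6.3.1–6.3.3 only
(deform IV (M′, blanket) followed by part XXV). [cite: Andre1996Motifs, §6.3 Remarque 2 (p. 33)]
[cite: Deligne1982HodgeCycles, Milne 2003 re-edition endnote 19] -/
theorem motivatedImpliesAlgebraicAV_of_andre1996_of_abelianSchemeVHC_holds
    (h₂₁ : andre1996_cmAnchoredPencil) (h₂₂ : andre1996_cmHodgeClasses_algebraicallyAnchoredPencils)
    (hV : AbelianSchemeVHC) : MotivatedImpliesAlgebraicAV :=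
  motivatedImpliesAlgebraicAV_of_hc_av_holds (HC_AV_of_andre1996_of_abelianSchemeVHC h₂₁ h₂₂ hV)

/-! ## §2 The binder-free rungs: motivated ⟹ algebraic in the Lefschetz range and in dimension `≤ 3` -/

section Rungs

variable {n : ℕ} {X : SchemeOver ℂ}

/-- **`A_motᵖ(X)_ℂ ⊆ Nᵖ H²ᵖ(X(ℂ); ℂ)` in the Lefschetz range of codimensions, unconditionally**: for `X` smooth
projective of dimension `n` and `p ≤ 1` or `n ≤ p + 1`, every motivated class is algebraic — motivated classes
lie in the `ℂ`-span of the rational `(p,p)`-classes (André §2.5 c), tree theorem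
`motivatedClasses_le_span_hodgeClasses`), and those are algebraic in this range (Lefschetz `(1,1)`, hard
Lefschetz; tree theorem `mem_algebraicClasses_of_lefschetzRange_holds`), `algebraicClasses X p` being a
`ℂ`-subspace. No named fact. [cite: Andre1996Motifs, §2.5 c) (p. 18) and §2.1 (p. 14)]
[cite: VoisinHodgeI2002, Thm. 6.25, Rem. 6.27, §7.1.2 and Thm. 11.30] [cite: KerrPearlstein2011, §3.1] -/
theorem motivatedClasses_le_algebraicClasses_of_lefschetzRange (hX : IsSmoothProjective n X) {p : ℕ}
    (hp : p ≤ 1 ∨ n ≤ p + 1) : motivatedClasses n X p ≤ algebraicClasses X p := by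
  refine (motivatedClasses_le_span_hodgeClasses hX p).trans (Submodule.span_le.2 ?_)
  rintro c ⟨hcQ, hcH⟩
  exact mem_algebraicClasses_of_lefschetzRange_holds hX hp c hcQ hcH

/-- **`A_motᵖ(X)_ℂ ⊆ Nᵖ H²ᵖ(X(ℂ); ℂ)` in every codimension on curves, surfaces and threefolds, unconditionally**:
for `X` smooth projective of dimension `n ≤ 3`, motivated classes are algebraic — the span fact and the Hodge
conjecture in dimension `≤ 3` (tree theorem `hodgeClasses_algebraic_of_dim_le_three_holds`: Lefschetz `(1,1)` and
`L : H² ≅ H⁴`). No named fact. [cite: Andre1996Motifs, §2.5 c) (p. 18)]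
[cite: VoisinHodgeII2003, §10.2.3 proof of Prop. 10.26] [cite: VoisinHodgeI2002, Thm. 6.25 and Thm. 11.30] -/
theorem motivatedClasses_le_algebraicClasses_of_dim_le_three (hn : n ≤ 3) (hX : IsSmoothProjective n X)
    (p : ℕ) : motivatedClasses n X p ≤ algebraicClasses X p := by
  refine (motivatedClasses_le_span_hodgeClasses hX p).trans (Submodule.span_le.2 ?_)
  rintro c ⟨hcQ, hcH⟩
  exact hodgeClasses_algebraic_of_dim_le_three_holds hn hX p c hcQ hcH

/-- **RUNG of the parent binder `MotivatedImpliesAlgebraic` (l.167): its restriction to varieties of dimension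
`≤ 3` HOLDS** — `A_mot(X) = A(X)` for every smooth projective complex curve, surface and threefold (the inclusion
`⊆`; the reverse inclusion is André's "il est clair", not part of the binder). Binder-free.
[cite: Andre1996Motifs, §2.1 remark following Déf. 1 (p. 14) and §2.5 c) (p. 18)]
[cite: VoisinHodgeII2003, §10.2.3 proof of Prop. 10.26] -/
theorem motivatedImpliesAlgebraic_dim_le_three :
    ∀ ⦃n : ℕ⦄ ⦃X : SchemeOver ℂ⦄, n ≤ 3 → IsSmoothProjective n X → ∀ p : ℕ,
      motivatedClasses n X p ≤ algebraicClasses X p :=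
  fun _ _ hn hX p ↦ motivatedClasses_le_algebraicClasses_of_dim_le_three hn hX p

/-- **RUNG of the parent binder in the Lefschetz range: for EVERY smooth projective complex `n`-fold,
`A_motᵖ(X)_ℂ ⊆ Nᵖ H²ᵖ` whenever `p ≤ 1` or `p ≥ n − 1`** (divisor classes, curve classes, the point and the
fundamental class). Binder-free. [cite: Andre1996Motifs, §2.5 c) (p. 18)]
[cite: VoisinHodgeI2002, Thm. 6.25 and Thm. 11.30] -/
theorem motivatedImpliesAlgebraic_lefschetzRange :
    ∀ ⦃n : ℕ⦄ ⦃X : SchemeOver ℂ⦄, IsSmoothProjective n X → ∀ p : ℕ, p ≤ 1 ∨ n ≤ p + 1 →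
      motivatedClasses n X p ≤ algebraicClasses X p :=
  fun _ _ hX _ hp ↦ motivatedClasses_le_algebraicClasses_of_lefschetzRange hX hp

/-- **RUNG (m2) of row b05: `MotivatedImpliesAlgebraicAV` HOLDS for abelian varieties of dimension `≤ 3`**
(elliptic curves, abelian surfaces, abelian threefolds): every motivated class on them is algebraic, in every
codimension. Binder-free (an abelian variety is smooth projective of dimension `A.dim`,
`AbelianVariety.isSmoothProjective_holds`). The row itself (all dimensions) stays OPEN.
[cite: Andre1996Motifs, Thm. 0.6.2 (p. 9) and §2.5 c) (p. 18)] [cite: VoisinHodgeII2003, §10.2.3 proof of Prop. 10.26] -/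
theorem motivatedImpliesAlgebraicAV_of_dim_le_three (A : AbelianVariety ℂ) (h3 : A.dim ≤ 3) (p : ℕ) :
    motivatedClasses A.dim A.X p ≤ algebraicClasses A.X p :=
  motivatedClasses_le_algebraicClasses_of_dim_le_three h3 (AbelianVariety.isSmoothProjective_holds (A := A)) p

/-- **RUNG of row b05 in the Lefschetz range: on EVERY complex abelian variety `A`, motivated classes of
codimension `p ≤ 1` or `p ≥ dim A − 1` are algebraic.** Binder-free. The content of row b05 is the complementary
range `2 ≤ p ≤ dim A − 2` (so `dim A ≥ 4`; e.g. André's motivated Weil classes on fourfolds of Weil type).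
[cite: Andre1996Motifs, Thm. 0.6.2 (p. 9) and §6.3 b) (p. 32)] [cite: VoisinHodgeI2002, Thm. 6.25 and Thm. 11.30] -/
theorem motivatedImpliesAlgebraicAV_of_lefschetzRange (A : AbelianVariety ℂ) {p : ℕ}
    (hp : p ≤ 1 ∨ A.dim ≤ p + 1) : motivatedClasses A.dim A.X p ≤ algebraicClasses A.X p :=
  motivatedClasses_le_algebraicClasses_of_lefschetzRange (AbelianVariety.isSmoothProjective_holds (A := A)) hp

end Rungs

/-! ## §3 The residue: the binders are equivalent to their middle-codimension parts -/

/-- **Row b05 IS its middle-codimension part**, unconditionally: `MotivatedImpliesAlgebraicAV` holds iff on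
every complex abelian variety `A` the motivated classes of every codimension `p` with `2 ≤ p` and `p + 2 ≤ dim A`
are algebraic — the Lefschetz range is binder-free (§2), so only abelian varieties of dimension `≥ 4` and the
codimensions strictly inside carry content (the range of André's §6.3: Thm. 0.5, Lemmes 6.3.1–6.3.3, where
nothing is asserted here). [cite: Andre1996Motifs, Thm. 0.6.2 (p. 9) and §6.3 (pp. 31–33)]
[cite: VoisinHodgeI2002, Thm. 6.25 and Thm. 11.30] -/
theorem motivatedImpliesAlgebraicAV_iff_middleRange :
    MotivatedImpliesAlgebraicAV ↔
      ∀ (A : AbelianVariety ℂ) (p : ℕ), 2 ≤ p → p + 2 ≤ A.dim →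
        motivatedClasses A.dim A.X p ≤ algebraicClasses A.X p := by
  refine ⟨fun h A p _ _ ↦ h A p, fun h A p ↦ ?_⟩
  by_cases hp : p ≤ 1 ∨ A.dim ≤ p + 1
  · exact motivatedImpliesAlgebraicAV_of_lefschetzRange A hp
  · exact h A p (by omega) (by omega)

/-- **The parent binder IS its middle-codimension part**, unconditionally: `MotivatedImpliesAlgebraic` (André's
`A_mot(X) = A(X)` for all smooth projective complex `X`) holds iff motivated classes of codimension `2 ≤ p ≤ n − 2`
are algebraic on every smooth projective `n`-fold (so `n ≥ 4`). [cite: Andre1996Motifs, §2.1 remark following Déf. 1 (p. 14)]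
[cite: VoisinHodgeI2002, Thm. 6.25 and Thm. 11.30] -/
theorem motivatedImpliesAlgebraic_iff_middleRange :
    MotivatedImpliesAlgebraic ↔
      ∀ ⦃n : ℕ⦄ ⦃X : SchemeOver ℂ⦄, IsSmoothProjective n X → ∀ p : ℕ, 2 ≤ p → p + 2 ≤ n →
        motivatedClasses n X p ≤ algebraicClasses X p := by
  refine ⟨fun h n X hX p _ _ ↦ h hX p, fun h n X hX p ↦ ?_⟩
  by_cases hp : p ≤ 1 ∨ n ≤ p + 1
  · exact motivatedClasses_le_algebraicClasses_of_lefschetzRange hX hp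
  · exact h hX p (by omega) (by omega)

/-- **The `dim ≤ 5` rung, modulo ONE print claim (displayed, never asserted)**: granted
`Markman2025_hodgeClasses_algebraic_abelian_dim_le_five` (arXiv:2509.23403 Cor. 1.3 — Moonen–Zarhin 1999 plus the
algebraicity of the Weil classes on abelian fourfolds of Weil type, arXiv:2502.03415; UNREFEREED, a hypothesis
`hM5` here), motivated classes on complex abelian varieties of dimension `≤ 5` are algebraic. For `dim A ≤ 3` the
claim is not needed (`motivatedImpliesAlgebraicAV_of_dim_le_three`). [claim: Markman2025SurveySecant, status: under-review]
[cite: Andre1996Motifs, §2.5 c) (p. 18)] -/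
theorem motivatedImpliesAlgebraicAV_of_dim_le_five_of_markman
    (hM5 : Markman2025_hodgeClasses_algebraic_abelian_dim_le_five) (A : AbelianVariety ℂ) (h5 : A.dim ≤ 5)
    (p : ℕ) : motivatedClasses A.dim A.X p ≤ algebraicClasses A.X p := by
  have hX := AbelianVariety.isSmoothProjective_holds (A := A)
  refine (motivatedClasses_le_span_hodgeClasses hX p).trans (Submodule.span_le.2 ?_)
  rintro c ⟨hcQ, hcH⟩
  exact hM5 A h5 hX p c hcQ hcH

/-! ## §4 The b05 ledger as one conjunction -/

/-- **Binder row b05, one conjunction a referee can quote.** (i) The bridges into `MotivatedImpliesAlgebraicAV`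
from the typed node `X` (the LANDED `hMH`-free bridge of `Ring2AbelianAllLefschetzPencilsOnPath`, imported, count
once) and from print's `X_A` (new), each modulo exactly three displayed print binders (`h₈`/`h₈A`, `h₂₁`, `h₂₂`);
(ii) the binder-free rungs — the parent binder in dimension `≤ 3` and in the Lefschetz range, hence row b05 for
abelian varieties of dimension `≤ 3` and in codimensions `p ≤ 1`, `p ≥ dim A − 1`; (iii) the row is equivalent to
its middle-codimension part. Nothing here asserts `HC_CM`, `HC_AV`, `X`, or row b05 itself.
[cite: Andre1996Motifs, Thm. 0.6.2 (p. 9), §2.1 (p. 14), §2.5 c) (p. 18), §6.3 Remarque 2 (p. 33)]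
[cite: Abdulali1994FamiliesAV, pp. 1122–1123] [cite: VoisinHodgeII2003, §10.2.3 proof of Prop. 10.26]
[cite: VoisinHodgeI2002, Thm. 6.25 and Thm. 11.30] -/
theorem b05_binder_ledger :
    (Abdulali1994_invariantCycles_of_lefschetzStandard → andre1996_cmAnchoredPencil →
        andre1996_cmHodgeClasses_algebraicallyAnchoredPencils →
        CompactAbelianPencilLefschetz → MotivatedImpliesAlgebraicAV) ∧
      (Abdulali1994_invariantCycles_of_lefschetzStandardA → andre1996_cmAnchoredPencil →
        andre1996_cmHodgeClasses_algebraicallyAnchoredPencils →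
        (CompactAbelianPencilStandardA → MotivatedImpliesAlgebraicAV)) ∧
      (∀ ⦃n : ℕ⦄ ⦃X : SchemeOver ℂ⦄, n ≤ 3 → IsSmoothProjective n X → ∀ p : ℕ,
        motivatedClasses n X p ≤ algebraicClasses X p) ∧
      (∀ ⦃n : ℕ⦄ ⦃X : SchemeOver ℂ⦄, IsSmoothProjective n X → ∀ p : ℕ, p ≤ 1 ∨ n ≤ p + 1 →
        motivatedClasses n X p ≤ algebraicClasses X p) ∧
      (∀ A : AbelianVariety ℂ, A.dim ≤ 3 → ∀ p : ℕ, motivatedClasses A.dim A.X p ≤ algebraicClasses A.X p) ∧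
      (∀ (A : AbelianVariety ℂ) (p : ℕ), p ≤ 1 ∨ A.dim ≤ p + 1 →
        motivatedClasses A.dim A.X p ≤ algebraicClasses A.X p) ∧
      (MotivatedImpliesAlgebraicAV ↔
        ∀ (A : AbelianVariety ℂ) (p : ℕ), 2 ≤ p → p + 2 ≤ A.dim →
          motivatedClasses A.dim A.X p ≤ algebraicClasses A.X p) :=
  ⟨Ring2.AbelianAll.motivatedImpliesAlgebraicAV_of_abdulali_of_andre1996_of_compactAbelianPencilLefschetz_holds,
    motivatedImpliesAlgebraicAV_of_abdulaliA_of_andre1996_of_compactAbelianPencilStandardA_holds,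
    motivatedImpliesAlgebraic_dim_le_three, motivatedImpliesAlgebraic_lefschetzRange,
    motivatedImpliesAlgebraicAV_of_dim_le_three, fun A _ hp ↦ motivatedImpliesAlgebraicAV_of_lefschetzRange A hp,
    motivatedImpliesAlgebraicAV_iff_middleRange⟩

end Summit.HodgeConjecture.HodgeConjecture.Ring2.Hypotheses

end
-- buildfix (ops-buildfix lane, 2026-08-20): comment-only re-land to enqueue the hub build after the Milne1999/CM chain repair (LEDGER C-7); no declaration changed.
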